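import Mathlib.Data.Matrix.Mul
import Mathlib.Data.Fin.Tuple.Basic
import Mathlib.Algebra.BigOperators.Fin
import Mathlib.Data.List.OfFn
import Mathlib.Tactic.Ring
import HarnessLib

/-!
# Route `DepthWindow`, g8 — path sums and blocks of an iterated matrix product (ABP semantics)

Second kernel piece of the `(2,3)` SLIVER LEMMA programme (lens-4 NODE-v7 §6 step (2)): the
algebra behind the meet-in-the-middle depth reduction of `IMM_{W,t}`.  For matrices
`M₀, …, M_{t-1} ∈ M_W(α)` over a commutative semiring:

* `bilin_imm_eq_sum_paths` — `xᵀ (M₀ ⋯ M_{t-1}) y = ∑_{s : Fin (t+1) → W} x_{s₀} · ∏ₗ (Mₗ)_{sₗ sₗ₊₁} · y_{s_t}`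
  (`pathWeight`), and the entry form `imm_apply_eq_sum_paths`: an iterated matrix product is a
  `Σ^{[W^{t-1}]} Π^{[t]}` formula in the matrix entries;
* `imm_blocks` — `M₀ ⋯ M_{ab-1} = ∏_{q<a} (∏_{u<b} M_{qb+u})`: grouping into `a` blocks of
  length `b`; with the path-sum form at both levels this is the
  `Σ^{[W^{a-1}]} Π^{[a]} Σ^{[W^{b-1}]} Π^{[b]}` normal form of `IMM_{W, ab}` — two product layers of
  fan-ins `a`, `b` instead of one of fan-in `ab`, at top fan-in `W^{a-1}` (`a = b = √t`: size
  `W^{O(√t)}`).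

Combined with `Theorems/DepthWindowTruncToeplitz.lean` (`[∏ₗ Vₗ]_e` = entry `(0, e)` of a
width-`(d+1)` IMM in the components `[Vₗ]_ε`) this is the component side of the sliver lemma;
the gate-level bookkeeping (merging the bottom `Π^{[b]}` with the product layer below,
`ΠΠ = Π`) is the next piece.  Pure `Matrix` algebra; nothing here bears on `VP ≠ VNP`.

[cite: LimayeSrinivasanTavenas2025, Lemma 11] [cite: Burgisser2000, Def. 2.1]
-/

set_option linter.dupNamespace false

namespace Summit.ValiantsHypothesis.ValiantsHypothesis.Theorems.DepthWindow

open Finset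

variable {n : Type*} [Fintype n] [DecidableEq n] {α : Type*} [CommSemiring α]

/-- The weight of the state path `s₀ → s₁ → ⋯ → s_t` through the layers `M₀, …, M_{t-1}`:
`∏ₗ (Mₗ)_{sₗ, sₗ₊₁}`. -/
def pathWeight {t : ℕ} (M : Fin t → Matrix n n α) (s : Fin (t + 1) → n) : α :=
  ∏ l : Fin t, M l (s l.castSucc) (s l.succ)

omit [Fintype n] [DecidableEq n] in
/-- Peeling the first layer off a path weight. -/
theorem pathWeight_cons {t : ℕ} (M : Fin (t + 1) → Matrix n n α) (a : n) (s' : Fin (t + 1) → n) :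
    pathWeight M (Fin.cons a s' : Fin (t + 2) → n) =
      M 0 a (s' 0) * pathWeight (fun l => M l.succ) s' := by
  simp only [pathWeight]
  rw [Fin.prod_univ_succ]
  refine congrArg₂ (· * ·) rfl ?_
  refine Fintype.prod_congr _ _ fun l => ?_
  have hl : (l.succ.castSucc : Fin (t + 2)) = l.castSucc.succ := Fin.ext rfl
  rw [hl, Fin.cons_succ, Fin.cons_succ]

/-- **Path-sum semantics of an iterated matrix product (bilinear form).**
`xᵀ (M₀ ⋯ M_{t-1}) y = ∑ₛ x_{s₀} · pathWeight M s · y_{s_t}`. [cite: Burgisser2000, Def. 2.1] -/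
theorem bilin_imm_eq_sum_paths :
    ∀ (t : ℕ) (M : Fin t → Matrix n n α) (x y : n → α),
      ∑ i, ∑ j, x i * (List.ofFn M).prod i j * y j =
        ∑ s : Fin (t + 1) → n, x (s 0) * pathWeight M s * y (s (Fin.last t))
  | 0, M, x, y => by
      have hpw : ∀ s : Fin 1 → n, pathWeight M s = 1 := fun s => by simp [pathWeight]
      simp_rw [hpw, List.ofFn_zero, List.prod_nil, mul_one]
      rw [Fintype.sum_equiv (Equiv.funUnique (Fin 1) n) (fun s : Fin 1 → n =>
        x (s 0) * y (s (Fin.last 0))) (fun i => x i * y i) (fun s => by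
          show x (s 0) * y (s (Fin.last 0)) = x (s default) * y (s default)
          rw [Subsingleton.elim (default : Fin 1) 0, @Subsingleton.elim (Fin 1) _ (Fin.last 0) 0])]
      refine Finset.sum_congr rfl fun i _ => ?_
      rw [Finset.sum_eq_single i]
      · rw [Matrix.one_apply_eq, mul_one]
      · intro j _ hji
        rw [Matrix.one_apply_ne (Ne.symm hji), mul_zero, zero_mul]
      · intro hi; exact absurd (Finset.mem_univ i) hi
  | t + 1, M, x, y => by
      rw [← Fintype.sum_equiv (Fin.consEquiv fun _ => n)
          (fun p : n × (Fin (t + 1) → n) =>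
            x p.1 * (M 0 p.1 (p.2 0) * pathWeight (fun l => M l.succ) p.2) * y (p.2 (Fin.last t)))
          (fun s => x (s 0) * pathWeight M s * y (s (Fin.last (t + 1))))
          (fun p => by
            show _ = x ((Fin.cons p.1 p.2 : Fin (t + 2) → n) 0) *
              pathWeight M (Fin.cons p.1 p.2 : Fin (t + 2) → n) *
              y ((Fin.cons p.1 p.2 : Fin (t + 2) → n) (Fin.last (t + 1)))
            rw [Fin.cons_zero, pathWeight_cons, ← Fin.succ_last, Fin.cons_succ]),
        Fintype.sum_prod_type]
      rw [List.ofFn_succ, List.prod_cons]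
      refine Finset.sum_congr rfl fun a _ => ?_
      have ih := bilin_imm_eq_sum_paths t (fun l => M l.succ) (fun k => M 0 a k) y
      have lhs : ∑ j, x a * (M 0 * (List.ofFn fun l => M l.succ).prod) a j * y j =
          x a * ∑ k, ∑ j, M 0 a k * (List.ofFn fun l => M l.succ).prod k j * y j := by
        rw [Finset.sum_comm, Finset.mul_sum]
        refine Finset.sum_congr rfl fun j _ => ?_
        rw [Matrix.mul_apply]
        simp only [Finset.mul_sum, Finset.sum_mul]
        refine Finset.sum_congr rfl fun k _ => ?_
        ring
      rw [lhs, ih, Finset.mul_sum]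
      refine Finset.sum_congr rfl fun s' _ => ?_
      ring

/-- **Entry form**: `(M₀ ⋯ M_{t-1}) i j` is the sum over state paths from `i` to `j` of the path
weights — a `Σ^{[W^{t-1}]} Π^{[t]}` formula in the entries. [cite: Burgisser2000, Def. 2.1] -/
theorem imm_apply_eq_sum_paths (t : ℕ) (M : Fin t → Matrix n n α) (i j : n) :
    (List.ofFn M).prod i j =
      ∑ s : Fin (t + 1) → n,
        (if s 0 = i then 1 else 0) * pathWeight M s * (if s (Fin.last t) = j then 1 else 0) := by
  rw [← bilin_imm_eq_sum_paths t M (fun k => if k = i then 1 else 0) (fun k => if k = j then 1 else 0)]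
  rw [Finset.sum_eq_single i]
  · rw [Finset.sum_eq_single j]
    · rw [if_pos rfl, if_pos rfl, one_mul, mul_one]
    · intro j' _ hj'; rw [if_neg hj', mul_zero]
    · intro hj; exact absurd (Finset.mem_univ j) hj
  · intro i' _ hi'
    refine Finset.sum_eq_zero fun j' _ => ?_
    rw [if_neg hi', zero_mul, zero_mul]
  · intro hi; exact absurd (Finset.mem_univ i) hi

/-- Index arithmetic for blocks. -/
theorem blockIndex_lt {a b : ℕ} (q : Fin a) (u : Fin b) : (q : ℕ) * b + u < a * b :=
  calc (q : ℕ) * b + u < (q : ℕ) * b + b := Nat.add_lt_add_left u.isLt _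
    _ = ((q : ℕ) + 1) * b := by ring
    _ ≤ a * b := Nat.mul_le_mul_right _ q.isLt

omit [Fintype n] [DecidableEq n] in
/-- **Blocks (meet in the middle).**  `M₀ ⋯ M_{ab-1} = ∏_{q<a} (∏_{u<b} M_{qb+u})`; with
`imm_apply_eq_sum_paths` at both levels, `IMM_{W,ab}` is a `Σ^{[W^{a-1}]} Π^{[a]} Σ^{[W^{b-1}]} Π^{[b]}`
formula in the entries. [cite: LimayeSrinivasanTavenas2025, Lemma 11] -/
theorem imm_blocks {β : Type*} [Monoid β] {a b : ℕ} (M : Fin (a * b) → β) :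
    (List.ofFn M).prod =
      (List.ofFn fun q : Fin a =>
        (List.ofFn fun u : Fin b => M ⟨(q : ℕ) * b + u, blockIndex_lt q u⟩).prod).prod := by
  rw [List.ofFn_mul, List.prod_flatten, List.map_ofFn]
  rfl

/-- **Two-level path sum.**  Entry `(i, j)` of `IMM_{W, ab}` as an explicit
`Σ Π Σ Π` expression in the entries: outer state paths `S : Fin (a+1) → W` from `i` to `j`, and for
each outer step `q` the inner path sum of block `q` between `S_q` and `S_{q+1}`. -/
theorem imm_apply_eq_sum_paths_blocks {a b : ℕ} (M : Fin (a * b) → Matrix n n α) (i j : n) :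
    (List.ofFn M).prod i j =
      ∑ S : Fin (a + 1) → n,
        (if S 0 = i then 1 else 0) *
          (∏ q : Fin a, ∑ s : Fin (b + 1) → n,
            (if s 0 = S q.castSucc then 1 else 0) *
              pathWeight (fun u : Fin b => M ⟨(q : ℕ) * b + u, blockIndex_lt q u⟩) s *
              (if s (Fin.last b) = S q.succ then 1 else 0)) *
          (if S (Fin.last a) = j then 1 else 0) := by
  rw [imm_blocks M, imm_apply_eq_sum_paths]
  simp only [pathWeight, imm_apply_eq_sum_paths]

end Summit.ValiantsHypothesis.ValiantsHypothesis.Theorems.DepthWindow
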